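import Summits.BirchSwinnertonDyer.BirchSwinnertonDyer.Theorems.SignedLowerHalvesSmallImageLowerHalfBothSignsRttRecipMTHeckeLConductor
import Summits.BirchSwinnertonDyer.BirchSwinnertonDyer.Theorems.SignedLowerHalvesSmallImageLowerHalfBothSignsRttRecipMTDepletedContinuation
import Literature.NumberTheory.EllipticCurves.Kato2004.EllipticUnitTatePairingValuesKOfGross
import Literature.NumberTheory.LFunctions.RayClassesColonIdeal
import Literature.NumberTheory.LFunctions.GrossencharakterWeightOneNorm
import HarnessLib

/-!
# Route `SignedLowerHalves`, crux L `SmallImageLowerHalfBothSigns` (stmt-BirchSwinnertonDyer-23599), line `rtt_w3` v43 — row S4‴ (`stub_junctionRecipValues_ns`), THE MATCH: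
# THE MAZUR–TATE SIDE `hMT` OF `hval_core` FROM honda's PERIOD TRANSPORT, through the θ-PIN SERIES IDENTITY and (AN)

WIDTH seat `bsd-line-slh-p3-w3` g30 under LEAD `cruxlead-stmt-BirchSwinnertonDyer-23599` g15 (cell `bsd-ssimc`; RULING «ROAD-𝔪» 17:04Z/17:11Z of 2026-08-31).
Helper `--supports stmt-BirchSwinnertonDyer-23599`. THEOREMS ONLY; no definition, no named fact, no instance, no `sorry`.

WHAT. `hval_core` (p827772) shares ONE series predicate between its Mazur–Tate input `hMT` and Kato's value law `hV`; after honda's ψ̄-free bridge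
(`prop159_values_inert_hV_frame_of_isGrossencharakter₂`, p829064) that predicate is
`Lser m χ′ Λ :↔ ∀ s, 3/2 < re s → Λ s = Σ'_I [I ⊥ p𝔣] ψ(I)·χ′⁻¹(N I)·N I^{−s}` (`p𝔣 = katoModulus p 𝔣 1`). honda's period transport
(`exists_period_transport_rayClass′`, p826103) speaks `rayClassLSeries 𝔣′ (w ↦ e(θ(φ_w))·χ⁻¹(N w))` for the depletion ideal `𝔣′` (`𝔣′ ∣ 𝔭_w ⟺ p ∈ 𝔭_w ∨ θ` ramified at `w`)
on `re s > σ₀ ≥ 2`. This file supplies the glue: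
* `le_iff_not_isUnramifiedAt_of_frameSupp` — under the frame's support conditions (R)/(U) for `θ′` (line-file `CharRoadFrameSupp`, here as its two conjuncts) and `θ′·θ = 1`:
  for `w ∤ p`, `𝔣 ∣ 𝔭_w ⟺ θ` ramified at `w`; hence ★ `isCoprime_depletion_iff`: `(I, 𝔣′) = 1 ⟺ (I, p𝔣) = 1`.
* ★★ `rayClassLSeries_thetaPin_eq_depleted` — THE θ-PIN SERIES IDENTITY: `rayClassLSeries 𝔣′ (w ↦ e(θ(φ_w))·χ′(N w)) s = Σ'_{(I,p𝔣)=1} ψ(I)·χ′(N I)·N I^{−s}` for ALL `s`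
  (termwise: multiplicativity `idealPow` of a product, `χ′(N I)`, and the pin `e(θ(Frob_w)) = ψ(w)` off `p𝔪` — every prime of an `I ⊥ p𝔣` is off `𝔪` BECAUSE `𝔪 ∣ 𝔣` (ROAD-𝔪 (P1))).
* `norm_apply_le_of_isGrossencharakter` — weight-one growth `‖ψ(𝔭)‖ ≤ N𝔭^{1/2}` off `𝔪` (`norm_idealPow_eq_sqrt_absNorm`, type `(1,0)` at `σK` via `prod_embedding_zpow_embType`).
* ★★★ `hMT_of_periodTransport` — `hval_core`'s `hMT` VERBATIM for the shared `Lser`: existence of an admissible `Λ` (the entire continuation of `L(g′ ⊗ χ⁻¹, s)`,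
  `exists_differentiable_eq_twistedLSeries_holds`, moved down to `re s > 3/2` by (AN) `eq_depletedSeries_of_eqOn_halfPlane`, p829196) and the value formula for every admissible `Λ`.
HONEST FRAMING: bookkeeping around two landed theorems; S4‴, crux L and BSD remain OPEN. References: [MazurTateTeitelbaum1986Invent] §I.8, §I.13; [Kato2004Asterisque] §15.9;
[NeukirchANT1999] Ch. VII §8 (8.1); [Shimura1971] Thm. 3.66.
-/

set_option autoImplicit false
set_option linter.dupNamespace false -- D-0017: single-problem summit, the namespace repeats the problem name by design
noncomputable section

open scoped Classical NumberField
open NumberField IsDedekindDomain Field Polynomial CongruenceSubgroup Complex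
open Literature.NumberTheory.EllipticCurves Literature.NumberTheory.EllipticCurves.ModularForms Literature.NumberTheory.GaloisRepresentations
  Literature.NumberTheory.LFunctions Literature.NumberTheory.ComplexMultiplication.EllipticUnits Literature.NumberTheory.ComplexMultiplication.EllipticUnits.JohnsonLeungKings2011
  Literature.NumberTheory.EllipticCurves.Kato2004.CM

namespace Summit.BirchSwinnertonDyer.BirchSwinnertonDyer.Theorems.SmallImageRttReciprocity

variable {p : ℕ} [Fact p.Prime] {K : Type} [Field K] [NumberField K] {S : Set (PadicAlgCl p)}

/-! ## §1 The support of the frame level: `𝔣 ∣ 𝔭_w ⟺ θ ramified at w` (`w ∤ p`) -/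

section Support

variable (θ : FramedGaloisRep K ↥(padicCoeffIntegers S) 1) {θ' : absoluteGaloisGroup K →ₜ* (↥(padicCoeffIntegers S))ˣ} (𝔣 : Ideal (𝓞 K))
  (hθ'θ : ∀ g : absoluteGaloisGroup K, ((θ' g : (↥(padicCoeffIntegers S))ˣ) : ↥(padicCoeffIntegers S)) *
    ((θ g : GL (Fin 1) ↥(padicCoeffIntegers S)) : Matrix (Fin 1) (Fin 1) ↥(padicCoeffIntegers S)) 0 0 = 1)

omit [NumberField K] in
include hθ'θ in
/-- `θ τ = 1 ⟺ θ′ τ = 1` when `θ′(τ)·θ(τ)₀₀ = 1` (rank one). [folklore] -/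
theorem apply_eq_one_iff_of_mul_eq_one (τ : absoluteGaloisGroup K) : θ τ = 1 ↔ θ' τ = 1 := by
  have h := hθ'θ τ
  constructor
  · intro h1
    rw [h1] at h
    have h2 : ((θ' τ : (↥(padicCoeffIntegers S))ˣ) : ↥(padicCoeffIntegers S)) = 1 := by
      simpa [Units.val_one] using h
    exact Units.ext h2
  · intro h1
    rw [h1, Units.val_one, one_mul] at h
    refine Units.ext (Matrix.ext fun i j ↦ ?_)
    rw [Subsingleton.elim i 0, Subsingleton.elim j 0, h, Units.val_one, Matrix.one_apply_eq]

include hθ'θ in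
/-- **Support of the frame level**: under (R) «every prime of `p𝔣` away from `p` is ramified for `θ′`» and (U) «`θ′` is unramified outside `supp(p𝔣)`» (the two conjuncts
of the line file's `CharRoadFrameSupp`) and `θ′·θ₀₀ = 1`: for `w ∤ p`, `𝔣 ≤ 𝔭_w ⟺ ¬ θ.IsUnramifiedAt w`. [cite: NeukirchANT1999, Ch. VI §6 Cor. (6.6)] -/
theorem le_iff_not_isUnramifiedAt_of_frameSupp
    (hR : ∀ w ∈ suppPF p 𝔣, ((p : ℕ) : 𝓞 K) ∉ w.asIdeal → ∃ 𝔓 ∈ w.primesAbove, ∃ τ ∈ 𝔓.inertia (absoluteGaloisGroup K), θ' τ ≠ 1)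
    (hU : ∀ w : HeightOneSpectrum (𝓞 K), w ∉ suppPF p 𝔣 → ∀ 𝔓 ∈ w.primesAbove, ∀ τ ∈ 𝔓.inertia (absoluteGaloisGroup K), θ' τ = 1)
    (w : HeightOneSpectrum (𝓞 K)) (hpw : ((p : ℕ) : 𝓞 K) ∉ w.asIdeal) : 𝔣 ≤ w.asIdeal ↔ ¬ θ.IsUnramifiedAt w := by
  have hsupp : w ∈ suppPF p 𝔣 ↔ 𝔣 ≤ w.asIdeal := by
    change w.asIdeal ∣ Ideal.span {((p : ℕ) : 𝓞 K)} * 𝔣 ↔ _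
    rw [Ideal.dvd_iff_le, Ideal.IsPrime.mul_le w.isPrime, Ideal.span_singleton_le_iff_mem]
    exact ⟨fun h ↦ h.resolve_left hpw, Or.inr⟩
  constructor
  · intro h𝔣w hunr
    obtain ⟨𝔓, h𝔓, τ, hτ, hne⟩ := hR w (hsupp.mpr h𝔣w) hpw
    exact hne ((apply_eq_one_iff_of_mul_eq_one θ hθ'θ τ).mp (hunr 𝔓 h𝔓 τ hτ))
  · intro hram
    by_contra h𝔣w
    apply hram
    intro 𝔓 h𝔓 τ hτ
    exact (apply_eq_one_iff_of_mul_eq_one θ hθ'θ τ).mpr (hU w (fun h ↦ h𝔣w (hsupp.mp h)) 𝔓 h𝔓 τ hτ)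

/-- ★ **The depletion ideal and `p𝔣` have the same support**: for `𝔣′` with `𝔣′ ≤ 𝔭_w ⟺ (p ∈ 𝔭_w ∨ θ` ramified at `w)` and `𝔣` as in
`le_iff_not_isUnramifiedAt_of_frameSupp`, `(I, 𝔣′) = 1 ⟺ (I, p𝔣) = 1` for every ideal `I`. [cite: NeukirchANT1999, Ch. I §3 (3.3)] -/
theorem isCoprime_depletion_iff {𝔣' : Ideal (𝓞 K)} (h𝔣'0 : 𝔣' ≠ ⊥) (h𝔣0 : 𝔣 ≠ ⊥)
    (h𝔣' : ∀ w : HeightOneSpectrum (𝓞 K), 𝔣' ≤ w.asIdeal ↔ (((p : ℕ) : 𝓞 K) ∈ w.asIdeal ∨ ¬ θ.IsUnramifiedAt w))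
    (hram : ∀ w : HeightOneSpectrum (𝓞 K), ((p : ℕ) : 𝓞 K) ∉ w.asIdeal → (𝔣 ≤ w.asIdeal ↔ ¬ θ.IsUnramifiedAt w)) (I : Ideal (𝓞 K)) :
    IsCoprime I 𝔣' ↔ IsCoprime I (katoModulus p 𝔣 1) := by
  have hp0 : ((p : ℕ) : 𝓞 K) ≠ 0 := by exact_mod_cast (Fact.out : p.Prime).ne_zero
  have h𝔠0 : katoModulus p 𝔣 1 ≠ ⊥ := by
    rw [katoModulus, pow_one]
    exact mul_ne_zero (mt Ideal.span_singleton_eq_bot.mp hp0) h𝔣0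
  have hkey : ∀ w : HeightOneSpectrum (𝓞 K), 𝔣' ≤ w.asIdeal ↔ katoModulus p 𝔣 1 ≤ w.asIdeal := fun w ↦ by
    rw [h𝔣', katoModulus, pow_one, Ideal.IsPrime.mul_le w.isPrime, Ideal.span_singleton_le_iff_mem]
    by_cases hpw : ((p : ℕ) : 𝓞 K) ∈ w.asIdeal
    · simp only [hpw, true_or]
    · simp only [hpw, false_or, hram w hpw]
  rw [isCoprime_iff_forall_not_le h𝔣'0, isCoprime_iff_forall_not_le h𝔠0]
  exact forall_congr' fun w ↦ by rw [hkey]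

end Support

/-! ## §2 The θ-pin series identity -/

section Pin

omit [Fact p.Prime] in
/-- `idealPow` of a pointwise product is the product (exponent vectors). [cite: NeukirchANT1999, Ch. VII §6] -/
theorem idealPow_mul_fun (f g : HeightOneSpectrum (𝓞 K) → ℂ) {I : Ideal (𝓞 K)} (hI : I ≠ ⊥) :
    idealPow K (fun w ↦ f w * g w) I = idealPow K f I * idealPow K g I := by
  obtain ⟨c, rfl⟩ := exists_finsuppProd_asIdeal_pow_eq (R := 𝓞 K) hI
  rw [idealPow_finsuppProd, idealPow_finsuppProd, idealPow_finsuppProd, ← Finsupp.prod_mul]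
  exact Finsupp.prod_congr fun v _ ↦ mul_pow _ _ _

omit [Fact p.Prime] in
/-- `idealPow` of `w ↦ χ′(N𝔭_w)` is `χ′(N I)` (`χ′` a multiplicative character of `ℤ/N`, `N` multiplicative on ideals). [cite: NeukirchANT1999, Ch. VII §6] -/
theorem idealPow_absNorm_mulChar {N : ℕ} (χ' : MulChar (ZMod N) ℂ) {I : Ideal (𝓞 K)} (hI : I ≠ ⊥) :
    idealPow K (fun w ↦ χ' ((Ideal.absNorm w.asIdeal : ℕ) : ZMod N)) I = χ' ((Ideal.absNorm I : ℕ) : ZMod N) := by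
  obtain ⟨c, rfl⟩ := exists_finsuppProd_asIdeal_pow_eq (R := 𝓞 K) hI
  rw [idealPow_finsuppProd, map_finsuppProd Ideal.absNorm]
  simp only [map_pow, Nat.cast_finsuppProd, Nat.cast_pow, map_finsuppProd χ', map_pow]

variable (θ : FramedGaloisRep K ↥(padicCoeffIntegers S) 1) (𝔣 : Ideal (𝓞 K)) {𝔪 : Ideal (𝓞 K)} (h𝔪𝔣 : 𝔪 ∣ 𝔣) (h𝔣0 : 𝔣 ≠ ⊥)
  {𝔣' : Ideal (𝓞 K)} (h𝔣'0 : 𝔣' ≠ ⊥)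
  (h𝔣' : ∀ w : HeightOneSpectrum (𝓞 K), 𝔣' ≤ w.asIdeal ↔ (((p : ℕ) : 𝓞 K) ∈ w.asIdeal ∨ ¬ θ.IsUnramifiedAt w))
  (hram : ∀ w : HeightOneSpectrum (𝓞 K), ((p : ℕ) : 𝓞 K) ∉ w.asIdeal → (𝔣 ≤ w.asIdeal ↔ ¬ θ.IsUnramifiedAt w))
  (e : PadicAlgCl p ≃+* ℂ) (φ : HeightOneSpectrum (𝓞 K) → absoluteGaloisGroup K) {ψ : HeightOneSpectrum (𝓞 K) → ℂ}
  (hpinv : ∀ w : HeightOneSpectrum (𝓞 K), ((p : ℕ) : 𝓞 K) ∉ w.asIdeal → ¬ 𝔪 ≤ w.asIdeal →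
    e ((((θ (φ w) : GL (Fin 1) ↥(padicCoeffIntegers S)) : Matrix (Fin 1) (Fin 1) ↥(padicCoeffIntegers S)) 0 0 : ↥(padicCoeffIntegers S)) : PadicAlgCl p) = ψ w)

include h𝔪𝔣 h𝔣0 h𝔣'0 h𝔣' hram hpinv in
/-- ★★ **THE θ-PIN SERIES IDENTITY** (all `s`): `rayClassLSeries 𝔣′ (w ↦ e(θ(φ_w))·χ′(N w)) s = Σ'_I [(I, p𝔣) = 1]·ψ(I)·χ′(N I)·N I^{−s}` — same support
(`isCoprime_depletion_iff`), and on an ideal prime to `p𝔣` every prime factor `w` has `p ∉ 𝔭_w` and `𝔪 ∤ 𝔭_w` (as `𝔪 ∣ 𝔣`), where the pin reads `e(θ(φ_w)) = ψ(w)`.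
[cite: NeukirchANT1999, Ch. VII §8 (8.1)] [cite: Kato2004Asterisque, Prop. 15.9] -/
theorem rayClassLSeries_thetaPin_eq_depleted (h𝔠top : katoModulus p 𝔣 1 ≠ ⊤) {N : ℕ} (χ' : MulChar (ZMod N) ℂ) (s : ℂ) :
    rayClassLSeries 𝔣' (fun w : HeightOneSpectrum (𝓞 K) ↦
        e ((((θ (φ w) : GL (Fin 1) ↥(padicCoeffIntegers S)) : Matrix (Fin 1) (Fin 1) ↥(padicCoeffIntegers S)) 0 0 : ↥(padicCoeffIntegers S)) : PadicAlgCl p) *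
          χ' ((Ideal.absNorm w.asIdeal : ℕ) : ZMod N)) s =
      ∑' I : Ideal (𝓞 K), (if IsCoprime I (katoModulus p 𝔣 1) then
        idealPow K ψ I * χ' ((Ideal.absNorm I : ℕ) : ZMod N) * ((Ideal.absNorm I : ℕ) : ℂ) ^ (-s) else 0) := by
  unfold rayClassLSeries
  refine tsum_congr fun I ↦ ?_
  have hsuppI : IsCoprime I 𝔣' ↔ IsCoprime I (katoModulus p 𝔣 1) := isCoprime_depletion_iff θ 𝔣 h𝔣'0 h𝔣0 h𝔣' hram I
  by_cases hI : IsCoprime I (katoModulus p 𝔣 1)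
  · have hI0 : I ≠ ⊥ := by
      rintro rfl
      exact h𝔠top (Ideal.isCoprime_iff_sup_eq.mp hI ▸ by simp)
    rw [if_pos hI, rayClassCoeff, if_pos ⟨hI0, hsuppI.mpr hI⟩, idealPow_mul_fun _ _ hI0, idealPow_absNorm_mulChar χ' hI0]
    congr 2
    -- the pin on every prime of `I`
    refine idealPow_congr_of_isCoprime (𝔪 := katoModulus p 𝔣 1) (fun w hw ↦ hpinv w ?_ ?_) hI
    · intro hpw
      exact hw (by rw [katoModulus, pow_one]; exact Ideal.mul_le_right.trans ((Ideal.span_singleton_le_iff_mem _).mpr hpw))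
    · intro h𝔪w
      exact hw (by rw [katoModulus, pow_one]; exact Ideal.mul_le_left.trans ((Ideal.le_of_dvd h𝔪𝔣).trans h𝔪w))
  · rw [if_neg hI, rayClassCoeff, if_neg (fun h ↦ hI (hsuppI.mp h.2)), zero_mul]

end Pin

/-! ## §3 Weight-one growth of `ψ` -/

section Growth

omit [Fact p.Prime]

/-- **`‖ψ(𝔭)‖ ≤ N𝔭^{1/2}` off `𝔪`** for a Grössencharakter of type `(1,0)` at `σK` of the imaginary quadratic `K` (in fact equality: `norm_idealPow_eq_sqrt_absNorm`).
[cite: deShalit1987, II.1.1 (p. 32–33)] [cite: NeukirchANT1999, Ch. VII §6 Prop. (6.13)] -/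
theorem norm_apply_le_of_isGrossencharakter (hK2 : Module.finrank ℚ K = 2) [IsTotallyComplex K] (σK : K →+* ℂ) {𝔪 : Ideal (𝓞 K)}
    (h𝔪 : 𝔪 ≠ ⊥) {ψ : HeightOneSpectrum (𝓞 K) → ℂ} (hψ : IsGrossencharakter 𝔪 (embType σK) (embTypeConj σK) ψ)
    (v : HeightOneSpectrum (𝓞 K)) (hv : ¬ 𝔪 ≤ v.asIdeal) :
    ‖ψ v‖ ≤ ‖((Ideal.absNorm v.asIdeal : ℕ) : ℂ) ^ (((1 / 2 : ℝ)) : ℂ)‖ := by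
  have hcop : IsCoprime v.asIdeal 𝔪 := by
    rw [isCoprime_iff_forall_not_le h𝔪]
    intro w hw hvw
    have : v = w := by
      haveI := v.isMaximal
      exact HeightOneSpectrum.ext (Ideal.IsMaximal.eq_of_le inferInstance w.isPrime.ne_top hvw)
    exact hv (this ▸ hw)
  have hrel : ∀ b c : 𝓞 K, b ≠ 0 → c ≠ 0 → IsCoprime (Ideal.span {c}) 𝔪 → b - c ∈ 𝔪 →
      idealPow K ψ (Ideal.span {b}) * σK c = idealPow K ψ (Ideal.span {c}) * σK b := fun b c hb hc hc𝔪 hbc ↦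
    idealPow_span_mul_eq_of_isGrossencharakter σK hψ (fun a _ ↦ prod_embedding_zpow_embType σK a) b c hb hc hc𝔪 hbc
      fun τ ↦ (not_nonempty_ringHom_real_of_isTotallyComplex K τ).elim
  have h := norm_idealPow_eq_sqrt_absNorm hK2 σK h𝔪 hψ.ne_zero hrel v.ne_bot hcop
  rw [idealPow_asIdeal] at h
  have hpos : 0 < Ideal.absNorm v.asIdeal := Nat.pos_of_ne_zero (Ideal.absNorm_eq_zero_iff.not.mpr v.ne_bot)
  rw [h, Complex.norm_natCast_cpow_of_pos hpos, Complex.ofReal_re, Real.sqrt_eq_rpow]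

end Growth

/-! ## §4 ★★★ `hMT` of `hval_core` from the period transport -/

section MT

variable {M : ℕ} [NeZero M] (g : CuspForm (Gamma0 M) 2) (ι : coeffField g →+* PadicAlgCl p) (Ω : ℂ) (e : PadicAlgCl p ≃+* ℂ)
  (θ : FramedGaloisRep K ↥(padicCoeffIntegers S) 1) (φ : HeightOneSpectrum (𝓞 K) → absoluteGaloisGroup K)
  (𝔣 𝔪 𝔣' : Ideal (𝓞 K)) (ψ : HeightOneSpectrum (𝓞 K) → ℂ) (g' : CuspForm (Gamma0 M) 2) (Ω' : ℂ)
  (hK2 : Module.finrank ℚ K = 2) [IsTotallyComplex K] (σK : K →+* ℂ) (h𝔪 : 𝔪 ≠ ⊥) (hψ : IsGrossencharakter 𝔪 (embType σK) (embTypeConj σK) ψ)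
  (h𝔪𝔣 : 𝔪 ∣ 𝔣) (h𝔣0 : 𝔣 ≠ ⊥) (h𝔠top : katoModulus p 𝔣 1 ≠ ⊤) (h𝔣'0 : 𝔣' ≠ ⊥)
  (h𝔣' : ∀ w : HeightOneSpectrum (𝓞 K), 𝔣' ≤ w.asIdeal ↔ (((p : ℕ) : 𝓞 K) ∈ w.asIdeal ∨ ¬ θ.IsUnramifiedAt w))
  (hram : ∀ w : HeightOneSpectrum (𝓞 K), ((p : ℕ) : 𝓞 K) ∉ w.asIdeal → (𝔣 ≤ w.asIdeal ↔ ¬ θ.IsUnramifiedAt w))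
  (hpinv : ∀ w : HeightOneSpectrum (𝓞 K), ((p : ℕ) : 𝓞 K) ∉ w.asIdeal → ¬ 𝔪 ≤ w.asIdeal →
    e ((((θ (φ w) : GL (Fin 1) ↥(padicCoeffIntegers S)) : Matrix (Fin 1) (Fin 1) ↥(padicCoeffIntegers S)) 0 0 : ↥(padicCoeffIntegers S)) : PadicAlgCl p) = ψ w)
  -- honda's period transport (the last conjunct of `exists_period_transport_rayClass'`)
  (hpkg : ∀ (n : ℕ) (ζ : PadicAlgCl p), IsPrimitiveRoot ζ (p ^ (n + 1)) →
    ∃ χ : DirichletCharacter ℂ (p ^ (n + 1 + cyclotomicExponent p)), χ.IsPrimitive ∧ χ.Even ∧ (∃ i : ℕ, orderOf χ = p ^ i) ∧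
      χ (cyclotomicGenerator p : ZMod (p ^ (n + 1 + cyclotomicExponent p))) = e ζ ∧
      (∃ σ₀ : ℝ, 2 ≤ σ₀ ∧ ∀ s : ℂ, σ₀ < s.re → twistedLSeries g' χ⁻¹ s =
        rayClassLSeries 𝔣' (fun w : HeightOneSpectrum (𝓞 K) ↦
          e ((((θ (φ w) : GL (Fin 1) ↥(padicCoeffIntegers S)) : Matrix (Fin 1) (Fin 1) ↥(padicCoeffIntegers S)) 0 0 : ↥(padicCoeffIntegers S)) :
            PadicAlgCl p) * χ⁻¹ ((Ideal.absNorm w.asIdeal : ℕ) : ZMod (p ^ (n + 1 + cyclotomicExponent p)))) s) ∧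
      ∀ {Λ : ℂ → ℂ}, Differentiable ℂ Λ →
        (∃ σ₁ : ℝ, ∀ s : ℂ, σ₁ < s.re → Λ s =
          rayClassLSeries 𝔣' (fun w : HeightOneSpectrum (𝓞 K) ↦
            e ((((θ (φ w) : GL (Fin 1) ↥(padicCoeffIntegers S)) : Matrix (Fin 1) (Fin 1) ↥(padicCoeffIntegers S)) 0 0 : ↥(padicCoeffIntegers S)) :
              PadicAlgCl p) * χ⁻¹ ((Ideal.absNorm w.asIdeal : ℕ) : ZMod (p ^ (n + 1 + cyclotomicExponent p)))) s) →
        Ω' * e ((mazurTateElementK g Ω p (n + 1)).eval₂ ι (ζ - 1)) =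
          gaussSum χ (ZMod.stdAddChar (N := p ^ (n + 1 + cyclotomicExponent p))) * Λ 1)

include hK2 σK h𝔪 hψ h𝔪𝔣 h𝔣0 h𝔠top h𝔣'0 h𝔣' hram hpinv hpkg in
/-- ★★★ **`hMT` of `hval_core` (p827772) for the shared series predicate** `Lser m χ′ Λ :↔ ∀ s, 3/2 < re s → Λ s = Σ'_I [(I,p𝔣)=1] ψ(I)·χ′⁻¹(N I)·N I^{−s}`:
for every `m` and primitive `ζ`, the character `χ` of the period transport with an ADMISSIBLE `Λ` (entire continuation of `L(g′ ⊗ χ⁻¹, s)` moved to `re s > 3/2` by (AN))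
and the value formula for every admissible `Λ` (θ-pin series identity). See the module docstring. [cite: MazurTateTeitelbaum1986Invent, §I.8, §I.13]
[cite: Kato2004Asterisque, Prop. 15.9] [cite: Shimura1971, Thm. 3.66] -/
theorem hMT_of_periodTransport :
    ∀ (m : ℕ) (ζ : PadicAlgCl p), IsPrimitiveRoot ζ (p ^ (m + 1)) →
      ∃ χ : DirichletCharacter ℂ (p ^ (m + 1 + cyclotomicExponent p)), χ.Even ∧ (∃ i : ℕ, orderOf χ = p ^ i) ∧
        χ (cyclotomicGenerator p : ZMod (p ^ (m + 1 + cyclotomicExponent p))) = e ζ ∧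
        (∃ Λ : ℂ → ℂ, Differentiable ℂ Λ ∧
          ∀ s : ℂ, 3 / 2 < s.re → Λ s = ∑' I : Ideal (𝓞 K), (if IsCoprime I (katoModulus p 𝔣 1) then
            idealPow K ψ I * χ⁻¹ ((Ideal.absNorm I : ℕ) : ZMod (p ^ (m + 1 + cyclotomicExponent p))) * ((Ideal.absNorm I : ℕ) : ℂ) ^ (-s) else 0)) ∧
        ∀ Λ : ℂ → ℂ, Differentiable ℂ Λ →
          (∀ s : ℂ, 3 / 2 < s.re → Λ s = ∑' I : Ideal (𝓞 K), (if IsCoprime I (katoModulus p 𝔣 1) then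
            idealPow K ψ I * χ⁻¹ ((Ideal.absNorm I : ℕ) : ZMod (p ^ (m + 1 + cyclotomicExponent p))) * ((Ideal.absNorm I : ℕ) : ℂ) ^ (-s) else 0)) →
          Ω' * e ((mazurTateElementK g Ω p (m + 1)).eval₂ ι (ζ - 1)) = gaussSum χ (ZMod.stdAddChar (N := p ^ (m + 1 + cyclotomicExponent p))) * Λ 1 := by
  intro m ζ hζ
  have hp' : p.Prime := Fact.out
  haveI : NeZero (p ^ (m + 1 + cyclotomicExponent p)) := ⟨pow_ne_zero _ hp'.ne_zero⟩
  obtain ⟨χ, -, heven, hord, hχγ, ⟨σ₀, h2σ₀, hident⟩, hval⟩ := hpkg m ζ hζ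
  -- the depletion modulus and the growth of `ψ`
  have hp0 : ((p : ℕ) : 𝓞 K) ≠ 0 := by exact_mod_cast hp'.ne_zero
  have h𝔠0 : katoModulus p 𝔣 1 ≠ ⊥ := by
    rw [katoModulus, pow_one]; exact mul_ne_zero (mt Ideal.span_singleton_eq_bot.mp hp0) h𝔣0
  have h𝔠𝔪 : katoModulus p 𝔣 1 ≤ 𝔪 := by rw [katoModulus, pow_one]; exact Ideal.mul_le_left.trans (Ideal.le_of_dvd h𝔪𝔣)
  have hgrowth : ∀ v : HeightOneSpectrum (𝓞 K), ¬ katoModulus p 𝔣 1 ≤ v.asIdeal → ‖ψ v‖ ≤ ‖((Ideal.absNorm v.asIdeal : ℕ) : ℂ) ^ (((1 / 2 : ℝ)) : ℂ)‖ :=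
    fun v hv ↦ norm_apply_le_of_isGrossencharakter hK2 σK h𝔪 hψ v fun h𝔪v ↦ hv (h𝔠𝔪.trans h𝔪v)
  -- the θ-pin identity for `χ⁻¹`
  have hpin : ∀ s : ℂ, rayClassLSeries 𝔣' (fun w : HeightOneSpectrum (𝓞 K) ↦
      e ((((θ (φ w) : GL (Fin 1) ↥(padicCoeffIntegers S)) : Matrix (Fin 1) (Fin 1) ↥(padicCoeffIntegers S)) 0 0 : ↥(padicCoeffIntegers S)) : PadicAlgCl p) *
        χ⁻¹ ((Ideal.absNorm w.asIdeal : ℕ) : ZMod (p ^ (m + 1 + cyclotomicExponent p)))) s =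
      ∑' I : Ideal (𝓞 K), (if IsCoprime I (katoModulus p 𝔣 1) then
        idealPow K ψ I * χ⁻¹ ((Ideal.absNorm I : ℕ) : ZMod (p ^ (m + 1 + cyclotomicExponent p))) * ((Ideal.absNorm I : ℕ) : ℂ) ^ (-s) else 0) :=
    fun s ↦ rayClassLSeries_thetaPin_eq_depleted θ 𝔣 h𝔪𝔣 h𝔣0 h𝔣'0 h𝔣' hram e φ hpinv h𝔠top χ⁻¹ s
  refine ⟨χ, heven, hord, hχγ, ?_, fun Λ hΛ hL ↦ hval hΛ ⟨3 / 2, fun s hs ↦ by rw [hpin s]; exact hL s hs⟩⟩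
  -- existence of an admissible `Λ`
  obtain ⟨Λ, hΛd, hΛ2⟩ := exists_differentiable_eq_twistedLSeries_holds g' χ⁻¹
  refine ⟨Λ, hΛd, eq_depletedSeries_of_eqOn_halfPlane h𝔠0 h𝔠top hgrowth χ⁻¹ hΛd (σ₁ := max σ₀ 2) fun s hs ↦ ?_⟩
  rw [hΛ2 s ((le_max_right _ _).trans_lt hs), hident s ((le_max_left _ _).trans_lt hs), hpin s]

end MT

end Summit.BirchSwinnertonDyer.BirchSwinnertonDyer.Theorems.SmallImageRttReciprocity

end
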